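import Summits.BirchSwinnertonDyer.Rank1Residual.Additive.UnramifiedKummerDisjoint
import Summits.BirchSwinnertonDyer.Rank1Residual.Additive.InertialTorsionAdditive
import Summits.BirchSwinnertonDyer.BirchSwinnertonDyer.Theorems.KatoDescentPotSupersingularKatoFiniteLevelStrictAdditiveTamagawa
import Summits.BirchSwinnertonDyer.BirchSwinnertonDyer.Theorems.KatoDescentPotSupersingularKatoFiniteLevelStrictLocalPTorsion
import Literature.NumberTheory.EllipticCurves.LocalEulerCharacteristicTorsion
import Literature.NumberTheory.EllipticCurves.KummerSelmerStructure
import HarnessLib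

set_option autoImplicit false

/-!
# (R1-d) AT FINITE LEVEL, the LOCAL INDEX: at a finite place `v ∤ p` of ADDITIVE reduction (`p` odd)
# `[𝓚_v ⊔ H¹_ur(K_v, E[p^k]) : 𝓚_v] = #E(K_v)[p^k]` for every `k`, `= #E(K_v)[p^∞] = p^{v_p(c_v)}` for `k ≫ 0`
# (seat `bsd-cm-prr-ty1` g11, cell `bsd-cm`; theorems only: no definition, no named fact, no instance, no `sorry`)

Part 24 of the seat's kernel cut of stub 3 `stub_rankOneCountReadingKato` of the Kato–Perrin-Riou skeletons v4 (cruxes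
stmt-BirchSwinnertonDyer-19945 / -19223; = cell bsd-potss's held input 27322).  Parts 22–23 (`KatoDescentKummerUnramifiedCount`,
`…Discharged`) prove the finite-level Poitou–Tate comparison `[H¹_{𝓚 ⊔ ur@Σ}(K, E[p^k]) : H¹_{𝓚 ⊓ ur@Σ}(K, E[p^k])] =
∏_{v∈Σ} [𝓚_v ⊔ H¹_ur(K_v, E[p^k]) : 𝓚_v]`.  THIS FILE evaluates the local factor at the places that occur on the rows of
stub 3 (every bad prime of a CM curve is additive):

* §1 `relIndex_kummer_sup_unramified_eq_natCard_unramified` — at any finite `v ∤ p`, if every `I_v`-fixed point of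
  `E[p^∞]` is killed by `p^k` (binder `hI`, theorem-shaped) then `𝓚_v ⊓ H¹_ur(K_v, E[p^k]) = ⊥` (n1011
  `unramifiedSubgroup_inf_kummerLocalConditionAt_pow_eq_bot_of_inertia_torsion`, Greenberg LNM 1716 p. 74) and hence
  **`[𝓚_v ⊔ H¹_ur : 𝓚_v] = #H¹_ur(K_v, E[p^k]) = #E(K_v)[p^k]`** (second isomorphism theorem; Milne I Lemma 2.9 in n1011's
  ramified form `natCard_unramifiedSubgroup_eq_natCard_invariants_general`; `#H⁰(K_v, E[n]) = #E(K_v)[n]`,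
  `natCard_invariants_torsion_restrictField`).
* §2 **`relIndex_kummer_sup_unramified_eq_natCard_torsion_of_hasAdditiveReductionAt`** — at an ADDITIVE `v ∤ p`, `p` odd,
  `hI` holds for every `k ≥ 1` (n1011 `inertia_torsion_of_hasAdditiveReductionAt`: `E(K_v^nr)[p^∞]` is killed by `p`,
  Kodaira–Néron), so `[𝓚_v ⊔ H¹_ur(K_v, E[p^k]) : 𝓚_v] = #E(K_v)[p^k]` for every `k ≥ 1`;
  **`exists_forall_le_relIndex_kummer_sup_unramified_eq_pow_padicValNat_localTamagawaNumber`** — for `k ≫ 0`,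
  `[𝓚_v ⊔ H¹_ur(K_v, E[p^k]) : 𝓚_v] = p^{v_p(c_v)}` (cell bsd-potss: `#E(K_v)[p^k] = #E(K_v)[p^∞]` for `k ≫ 0`,
  `exists_forall_natCard_ker_nsmul_eq_natCard_primaryComponent`, and `#E(K_v)[p^∞] = p^{v_p(c_v)}` at an additive `v ∤ p`,
  `natCard_primaryComponent_point_eq_pow_padicValNat_localTamagawaNumber_of_hasAdditiveReductionAt`, Silverman VII.6.1).
* §3 **`exists_forall_le_prod_relIndex_kummer_sup_unramified_eq`** — over a finite set `Σ` of additive places `v ∤ p`: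
  `∃ k₀, ∀ k ≥ k₀, ∏_{v∈Σ} [𝓚_v ⊔ H¹_ur(K_v, E[p^k]) : 𝓚_v] = ∏_{v∈Σ} p^{v_p(c_v)}` — the constant `C′ = ∏_{ℓ ≠ p} c_ℓ^{(p)}` of
  the potss memo's (R1-d) «`#(S(T)/Sel) = C′/p^a`».

HONEST LABEL: theorems only; no stub or item is closed; nothing is registered; nothing is asserted on 19945 / 19223;
Kato's Main Conjecture and Perrin-Riou's conjecture are not touched; BSD is not proved for any curve.

References: [GreenbergLNM1716] §2–§4 (pp. 63, 74); [MilneADT2006] Ch. I Lemma 2.9, Lemma 3.3; [SilvermanAEC2009] Thm. VII.6.1,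
Prop. VII.6.3; [Kato2004Asterisque] §14.8 (p. 238); [Rubin2000] Thm. 1.7.3.
-/

noncomputable section

open scoped Classical ContRepresentation NumberField
open Function Field NumberField IsDedekindDomain WeierstrassCurve
open Literature.NumberTheory.EllipticCurves Literature.NumberTheory.GaloisRepresentations
  Literature.NumberTheory.GaloisRepresentations.DiscreteGaloisModule Literature.NumberTheory.GaloisCohomology
open Summit.BirchSwinnertonDyer.Rank1Residual.X11b.LocBridge
open Summit.BirchSwinnertonDyer.BirchSwinnertonDyer.Theorems.KatoFiniteLevelCount


namespace Summit.BirchSwinnertonDyer.Rank1Residual.Additive.KummerUnramified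

variable {K : Type} [Field K] [NumberField K] (W : WeierstrassCurve K) [W.IsElliptic] (p : ℕ) [hp : Fact p.Prime]
  (v : HeightOneSpectrum (𝓞 K))

/-! ## §1 The local index under the inertia-torsion binder -/

/-- **`[𝓚_v ⊔ H¹_ur(K_v, E[p^k]) : 𝓚_v] = #H¹_ur(K_v, E[p^k])` at `v ∤ p` when `E(K_v^nr)[p^∞]` is killed by `p^k`**: the two
local conditions are disjoint (n1011), and `[A ⊔ B : A] = [B : A ⊓ B]`. [cite: GreenbergLNM1716, §4 proof of Thm. 4.1 (p. 74)] -/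
theorem relIndex_kummer_sup_unramified_eq_natCard_unramified (hpv : ((p : ℕ) : 𝓞 K) ∉ v.asIdeal) (k : ℕ)
    (hI : ∀ Q : W.geomPrimaryTorsion p,
      (∀ τ ∈ absInertia (v.adicCompletion K),
        GaloisRep.restrictField (v.adicCompletion K) (primaryGaloisModule W p) τ Q = Q) → p ^ k • Q = 0) :
    (W.kummerSelmerStructure ((p ^ k : ℕ) : ℤ) (Sum.inr v)).relIndex
        (W.kummerSelmerStructure ((p ^ k : ℕ) : ℤ) (Sum.inr v) ⊔
          unramifiedSubgroup (GaloisRep.toLocal v (W.torsionGaloisModule ((p ^ k : ℕ) : ℤ))) 1) =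
      Nat.card (unramifiedSubgroup (GaloisRep.toLocal v (W.torsionGaloisModule ((p ^ k : ℕ) : ℤ))) 1) := by
  have hbot : W.kummerSelmerStructure ((p ^ k : ℕ) : ℤ) (Sum.inr v) ⊓
      unramifiedSubgroup (GaloisRep.toLocal v (W.torsionGaloisModule ((p ^ k : ℕ) : ℤ))) 1 = ⊥ := by
    rw [inf_comm]
    exact unramifiedSubgroup_inf_kummerLocalConditionAt_pow_eq_bot_of_inertia_torsion W p v hpv k hI
  rw [AddSubgroup.relIndex_sup_left, ← AddSubgroup.inf_relIndex_right, hbot, AddSubgroup.relIndex_bot_left]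
  rfl

/-- **`[𝓚_v ⊔ H¹_ur(K_v, E[p^k]) : 𝓚_v] = #E(K_v)[p^k]`** under the same binder: `#H¹_ur(K_v, E[p^k]) = #H⁰(K_v, E[p^k])`
(Milne I Lemma 2.9 for the possibly ramified finite module `E[p^k]`) `= #E(K_v)[p^k]`.
[cite: MilneADT2006, Ch. I, Lemma 2.9 and Lemma 3.3] [cite: GreenbergLNM1716, §4 proof of Thm. 4.1 (p. 74)] -/
theorem relIndex_kummer_sup_unramified_eq_natCard_torsion (hpv : ((p : ℕ) : 𝓞 K) ∉ v.asIdeal) (k : ℕ)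
    (hI : ∀ Q : W.geomPrimaryTorsion p,
      (∀ τ ∈ absInertia (v.adicCompletion K),
        GaloisRep.restrictField (v.adicCompletion K) (primaryGaloisModule W p) τ Q = Q) → p ^ k • Q = 0) :
    (W.kummerSelmerStructure ((p ^ k : ℕ) : ℤ) (Sum.inr v)).relIndex
        (W.kummerSelmerStructure ((p ^ k : ℕ) : ℤ) (Sum.inr v) ⊔
          unramifiedSubgroup (GaloisRep.toLocal v (W.torsionGaloisModule ((p ^ k : ℕ) : ℤ))) 1) =
      Nat.card (nsmulAddMonoidHom (p ^ k) : (W.baseChange (v.adicCompletion K)).toAffine.Point →+ _).ker := by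
  haveI : NeZero (p ^ k) := ⟨pow_ne_zero k hp.out.ne_zero⟩
  haveI : Finite (geomTorsion W ((p ^ k : ℕ) : ℤ)) := finite_geomTorsion_of_neZero W (p ^ k)
  haveI : CharZero (v.adicCompletion K) := charZero_adicCompletion v
  rw [relIndex_kummer_sup_unramified_eq_natCard_unramified W p v hpv k hI]
  change Nat.card (unramifiedSubgroup
    (GaloisRep.restrictField (v.adicCompletion K) (W.torsionGaloisModule ((p ^ k : ℕ) : ℤ))) 1) = _
  rw [natCard_unramifiedSubgroup_eq_natCard_invariants_general, ← natCard_invariants_torsion_restrictField W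
    (v.adicCompletion K) (NeZero.ne (p ^ k))]

/-! ## §2 Additive places `v ∤ p`, `p` odd: the binder discharged; the Tamagawa value for `k ≫ 0` -/

/-- **`[𝓚_v ⊔ H¹_ur(K_v, E[p^k]) : 𝓚_v] = #E(K_v)[p^k]` for every `k ≥ 1` at an ADDITIVE `v ∤ p`, `p` odd** — the binder `hI` holds
there with exponent one (Kodaira–Néron over `K_v^nr`: n1011 `inertia_torsion_of_hasAdditiveReductionAt`).
[cite: SilvermanAEC2009, Thm. VII.6.1] [cite: GreenbergLNM1716, §4 proof of Thm. 4.1 (p. 74)] -/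
theorem relIndex_kummer_sup_unramified_eq_natCard_torsion_of_hasAdditiveReductionAt (hpv : ((p : ℕ) : 𝓞 K) ∉ v.asIdeal)
    (hp2 : p ≠ 2) (hadd : W.HasAdditiveReductionAt v) {k : ℕ} (hk : 1 ≤ k) :
    (W.kummerSelmerStructure ((p ^ k : ℕ) : ℤ) (Sum.inr v)).relIndex
        (W.kummerSelmerStructure ((p ^ k : ℕ) : ℤ) (Sum.inr v) ⊔
          unramifiedSubgroup (GaloisRep.toLocal v (W.torsionGaloisModule ((p ^ k : ℕ) : ℤ))) 1) =
      Nat.card (nsmulAddMonoidHom (p ^ k) : (W.baseChange (v.adicCompletion K)).toAffine.Point →+ _).ker :=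
  relIndex_kummer_sup_unramified_eq_natCard_torsion W p v hpv k fun Q hQ => by
    rw [← Nat.sub_add_cancel hk, pow_succ, mul_smul, inertia_torsion_of_hasAdditiveReductionAt W p v hpv hp2 hadd Q hQ,
      smul_zero]

/-- **`[𝓚_v ⊔ H¹_ur(K_v, E[p^k]) : 𝓚_v] = p^{v_p(c_v)}` for all large `k` at an ADDITIVE `v ∤ p`, `p` odd**: `#E(K_v)[p^k] =
#E(K_v)[p^∞]` for `k ≫ 0` (Silverman VII.6.3, cell bsd-potss) and `#E(K_v)[p^∞] = p^{v_p(c_v)}` at an additive `v ∤ p`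
(Kodaira–Néron VII.6.1/6.2 with VII.2.1, VII.3.1, cell bsd-potss) — Greenberg's «`#ker r_v = c_v^{(p)}`», Kato's §14.8 summand.
[cite: SilvermanAEC2009, Thm. VII.6.1 and Prop. VII.6.3] [cite: GreenbergLNM1716, §4 proof of Thm. 4.1 (p. 74)]
[cite: Kato2004Asterisque, §14.8 (p. 238)] -/
theorem exists_forall_le_relIndex_kummer_sup_unramified_eq_pow_padicValNat_localTamagawaNumber
    (hpv : ((p : ℕ) : 𝓞 K) ∉ v.asIdeal) (hp2 : p ≠ 2) (hadd : W.HasAdditiveReductionAt v) :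
    ∃ k₀ : ℕ, ∀ k, k₀ ≤ k →
      (W.kummerSelmerStructure ((p ^ k : ℕ) : ℤ) (Sum.inr v)).relIndex
          (W.kummerSelmerStructure ((p ^ k : ℕ) : ℤ) (Sum.inr v) ⊔
            unramifiedSubgroup (GaloisRep.toLocal v (W.torsionGaloisModule ((p ^ k : ℕ) : ℤ))) 1) =
        p ^ padicValNat p ((W.baseChange (v.adicCompletion K)).localTamagawaNumber (v.adicCompletionIntegers K)) := by
  obtain ⟨a, ha⟩ := exists_forall_natCard_ker_nsmul_eq_natCard_primaryComponent W p v
  refine ⟨a + 1, fun k hk => ?_⟩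
  rw [relIndex_kummer_sup_unramified_eq_natCard_torsion_of_hasAdditiveReductionAt W p v hpv hp2 hadd (by omega),
    ha k (by omega)]
  exact natCard_primaryComponent_point_eq_pow_padicValNat_localTamagawaNumber_of_hasAdditiveReductionAt W p v hpv hadd

/-! ## §3 The product over a finite set of additive places -/

/-- **`∃ k₀, ∀ k ≥ k₀: ∏_{v∈Σ} [𝓚_v ⊔ H¹_ur(K_v, E[p^k]) : 𝓚_v] = ∏_{v∈Σ} p^{v_p(c_v)}`** for a finite set `Σ` of additive places
`v ∤ p` (`p` odd) — the constant `C′ = ∏ c_v^{(p)}` of the Poitou–Tate comparison (R1-d).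
[cite: Rubin2000, Thm. 1.7.3] [cite: GreenbergLNM1716, §4 proof of Thm. 4.1 (p. 74)] -/
theorem exists_forall_le_prod_relIndex_kummer_sup_unramified_eq (hp2 : p ≠ 2) (Q : Finset (HeightOneSpectrum (𝓞 K)))
    (hQp : ∀ v ∈ Q, ((p : ℕ) : 𝓞 K) ∉ v.asIdeal) (hQadd : ∀ v ∈ Q, W.HasAdditiveReductionAt v) :
    ∃ k₀ : ℕ, ∀ k, k₀ ≤ k →
      ∏ v ∈ Q, (W.kummerSelmerStructure ((p ^ k : ℕ) : ℤ) (Sum.inr v)).relIndex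
          (W.kummerSelmerStructure ((p ^ k : ℕ) : ℤ) (Sum.inr v) ⊔
            unramifiedSubgroup (GaloisRep.toLocal v (W.torsionGaloisModule ((p ^ k : ℕ) : ℤ))) 1) =
        ∏ v ∈ Q, p ^ padicValNat p ((W.baseChange (v.adicCompletion K)).localTamagawaNumber (v.adicCompletionIntegers K)) := by
  classical
  -- a threshold for every place of `Q`
  have hloc : ∀ v ∈ Q, ∃ k₀ : ℕ, ∀ k, k₀ ≤ k →
      (W.kummerSelmerStructure ((p ^ k : ℕ) : ℤ) (Sum.inr v)).relIndex
          (W.kummerSelmerStructure ((p ^ k : ℕ) : ℤ) (Sum.inr v) ⊔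
            unramifiedSubgroup (GaloisRep.toLocal v (W.torsionGaloisModule ((p ^ k : ℕ) : ℤ))) 1) =
        p ^ padicValNat p ((W.baseChange (v.adicCompletion K)).localTamagawaNumber (v.adicCompletionIntegers K)) :=
    fun v hv => exists_forall_le_relIndex_kummer_sup_unramified_eq_pow_padicValNat_localTamagawaNumber W p v (hQp v hv) hp2
      (hQadd v hv)
  choose! f hf using hloc
  refine ⟨Q.sup f, fun k hk => Finset.prod_congr rfl fun v hv => hf v hv k ((Finset.le_sup hv).trans hk)⟩

end Summit.BirchSwinnertonDyer.Rank1Residual.Additive.KummerUnramified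

end
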